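import Mathlib
import Summits.ValiantsHypothesis.ValiantsHypothesis.Theorems.NewtonUnitEquationsNewtonTauWeakAutomatonDefs

/-!
# `NewtonUnitEquationsNewtonTauWeakAutomatonRecursion` — carry automaton: bilinear self-similarity

Rung toward `stub_binomialNewtonTauCommon` (crux `NewtonTauWeak`, stmt-ValiantsHypothesis-5904), line
`binomial-normal-form`, CARRY-AUTOMATON rung: registered stub `stub_autoRecursion`.

Claim.  Reading the levels `[0, h+m)` of the position `P = 2^h H + L` (`L` in the low box `[0, 2^h)²`) is reading
the levels `[0, h)` of `L` and then the levels `[0, m)` of `H` with the level parameters shifted by `h`: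
as matrices `N^{[0,h+m)}(P) = N^{[0,h)}(L) · N^{[h,h+m)}(P) = N_low(L) · N_high(H)`, and `hexContract K (kron high low)`
is by definition the vector of entries of the blockwise products `N_low · N_high`.

Proof.  `List.range' 0 (h+m) = List.range' 0 h ++ List.range' h m` splits the ordered product (`hexN_split`); the
low factor only reads binary digits below `h`, which are those of `L` (`Nat.testBit_two_pow_mul_add`, `hexN_low`);
the high factor reads the digits `h+i`, `i < m`, which are the digits `i` of `H` (`hexN_high`, reindexing
`List.range' h m = (List.range m).map (h + ·)`).  Then unfold `hexContract`, `kron`, `hexVecFin` at an index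
`idxEquiv K (l, κ, κ'')` and recognise `Matrix.mul_apply`. [folklore: carry automaton / transfer matrices of digit
expansions]
-/

set_option linter.dupNamespace false

noncomputable section

open scoped BigOperators

namespace Summit.ValiantsHypothesis.ValiantsHypothesis.Theorems.NewtonTauWeakAutomaton

namespace AutoRecursionAux

/-- Splitting the levels: the ordered product over `[0, h+m)` is the product over `[0, h)` times the product
over `[h, h+m)`. [folklore] -/
theorem hexN_split (a b g : ℕ → ℂ) (h m : ℕ) (P : ℕ × ℕ) :
    hexN a b g 0 (h + m) P = hexN a b g 0 h P * hexN a b g h m P := by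
  unfold hexN
  rw [← List.range'_append_1, Nat.zero_add, List.map_append, List.prod_append]

/-- The low factor of `P = 2^h H + L` (`L` in the low box) only reads the digits of `L`. [folklore] -/
theorem hexN_low (a b g : ℕ → ℂ) (h : ℕ) (H L : ℕ × ℕ) (hL : L.1 < 2 ^ h ∧ L.2 < 2 ^ h) :
    hexN a b g 0 h (2 ^ h * H.1 + L.1, 2 ^ h * H.2 + L.2) = hexN a b g 0 h L := by
  unfold hexN
  congr 1
  apply List.map_congr_left
  intro i hi
  rw [List.mem_range'_1] at hi
  have hi' : i < h := by omega
  dsimp only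
  rw [Nat.testBit_two_pow_mul_add _ hL.1, Nat.testBit_two_pow_mul_add _ hL.2, if_pos hi', if_pos hi']

/-- The high factor of `P = 2^h H + L` (`L` in the low box) reads the digits of `H`, with the level parameters
shifted by `h`. [folklore] -/
theorem hexN_high (a b g : ℕ → ℂ) (h m : ℕ) (H L : ℕ × ℕ) (hL : L.1 < 2 ^ h ∧ L.2 < 2 ^ h) :
    hexN a b g h m (2 ^ h * H.1 + L.1, 2 ^ h * H.2 + L.2) =
      hexN (fun i => a (i + h)) (fun i => b (i + h)) (fun i => g (i + h)) 0 m H := by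
  unfold hexN
  rw [List.range'_eq_map_range, List.range'_eq_map_range, List.map_map, List.map_map]
  congr 1
  apply List.map_congr_left
  intro i _
  simp only [Function.comp_apply, Nat.zero_add]
  rw [Nat.testBit_two_pow_mul_add _ hL.1, Nat.testBit_two_pow_mul_add _ hL.2, if_neg (by omega),
    if_neg (by omega), Nat.add_sub_cancel_left, Nat.add_comm h i]

end AutoRecursionAux

open AutoRecursionAux in
/-- **Bilinear self-similarity of the carry-automaton configuration.**  The configuration vector over the levels
`[0, h+m)` at the position `2^h H + L` (`L` in the low box `[0, 2^h)²`) is the contraction `hexContract K` of the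
Kronecker product of the level-`[0, m)` configuration at `H` with parameters shifted by `h` (high digits) and the
level-`[0, h)` configuration at `L` (low digits): blockwise, `N^{[0,h+m)}(2^h H + L) = N_low(L) · N_high(H)`.
[folklore: carry automaton / transfer matrices of digit expansions] -/
theorem stub_autoRecursion (K h m : ℕ) (a b g : Fin K → ℕ → ℂ) (H L : ℕ × ℕ) (hL : L.1 < 2 ^ h ∧ L.2 < 2 ^ h) :
    hexVecFin K a b g 0 (h + m) (2 ^ h * H.1 + L.1, 2 ^ h * H.2 + L.2) =
      hexContract K (kron (hexVecFin K (shiftPar a h) (shiftPar b h) (shiftPar g h) 0 m H)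
        (hexVecFin K a b g 0 h L)) := by
  funext j
  obtain ⟨i, rfl⟩ : ∃ i, j = idxEquiv K i := ⟨(idxEquiv K).symm j, by simp⟩
  obtain ⟨l, κ, κ''⟩ := i
  simp only [hexContract, LinearMap.coe_mk, AddHom.coe_mk, kron, hexVecFin, hexVec, Equiv.symm_apply_apply]
  rw [hexN_split, hexN_low (a l) (b l) (g l) h H L hL, hexN_high (a l) (b l) (g l) h m H L hL, Matrix.mul_apply]
  exact Finset.sum_congr rfl fun κ' _ => mul_comm _ _

end Summit.ValiantsHypothesis.ValiantsHypothesis.Theorems.NewtonTauWeakAutomaton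

end
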